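import Mathlib
import Literature.Geometry.Lorentzian.KerrSchildChartCovariance
import Literature.Geometry.Lorentzian.CoordRicciCovariance
import Summits.FinalStateConjecture.FinalStateConjecture.Theorems.EIHFluxBalanceInertialRecessionStubSlaving3ZeroSet

/-!
# Route EIHFluxBalance — `ModulatedKerrHandoff`, stub `stub_dragDefect`: the dragged superposition
# and its Ricci-flat comparison field

Helper file for the crux `stmt-FinalStateConjecture-10167`
(`Summit.FinalStateConjecture.FinalStateConjecture.Theses.EIHFluxBalance.ModulatedKerrHandoff`),
line `overlap-modulation-second-iterate`, stub `stub_dragDefect`.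

Two fields of bilinear forms on `E4` built from the form field `P` of hole 1 (Schwarzschild,
Kerr–Schild Cartesian coordinates, `P = g_{M₁,0}`) and the form field `Q` of hole 2, a linear
drag `A : E4 →L E4` and a constant form `c`:

* the DRAGGED SUPERPOSITION `F(y) = η + (P y − η) + (Q y − η) + L(y)`,
  `L(y) = D(P − η)(y)[Ay] + (P y − η)(A·,·) + (P y − η)(·,A·)` (the crux's second iterate with a
  frozen reference event), and
* the AFFINE PULL-BACK `g₁ = (1 + A)^*P`, `g₁(y) = P(y + Ay)((1+A)·,(1+A)·)`
  (`MetricCoord.pullMetric P (y ↦ y + Ay)`, `pullMetric_affine`),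

and the algebra/analysis linking them:

* `dragged_sub_pullback` — the POINTWISE identity
  `F y − g₁ y = (Q y − η − c) − AᵀηA + E(y)` whenever `η(A·,·) + η(·,A·) = c`, with the drag error
  `E(y) = (P y − η) + D(P−η)(y)[Ay] + (P y − η)(A·,·) + (P y − η)(·,A·) − (1+A)^*(P − η)(y)`
  (a sum of Taylor remainders of `P − η` along `y ↦ y + Ay`, cf. `…DragDefectTaylor`) and its scalar
  components (`dragError_apply`);
* `isCoordChangeOn_affine`, `isMetricOn_pullback_kerr`, `ricAt_pullback_kerr_eq_zero` — for
  `P = g_{M,0}` and `‖A‖ < 1`, `g₁` is a field of metric components on `{‖(y + Ay)̲‖ > 0}` with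
  vanishing coordinate Ricci form (naturality, `MetricCoord.IsMetricOn.ricAt_pullMetric_eq_zero`,
  and `Ric(g_{M,0}) = 0`, `ricAt_kerr_bilin_zero_spin`);
* `isMetricOn_const_minkowski`, `ricAt_const_minkowski`, `isMetricOn_kerr_sub`, `ricAt_kerr_sub` —
  the constant field `η` and the translated hole `y ↦ g_{M,0}(y − c₂)` are metric components with
  vanishing Ricci form off the translated axis;
* `contDiffAt_dragged`, `dragged_symm`, `isMetricOn_dragged` — `F` is smooth and symmetric off the
  two axes, and gives metric components on the open set where it is moreover invertible.
-/

noncomputable section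

-- `Summit.<S>.<S>.…` (single-problem summit, D-0017) trips core's duplicate-namespace linter.
set_option linter.dupNamespace false
set_option maxSynthPendingDepth 3

open Set Function Filter ContinuousLinearMap Literature.Geometry.Lorentzian
  Literature.Geometry.Lorentzian.MetricCoord
open Summit.FinalStateConjecture.FinalStateConjecture.Theorems.SublinearIsFree.Slaving
  (isMetricOn_kerr_bilin ricAt_kerr_bilin_zero_spin isCoordChangeOn_poincareInv
    pullMetric_kerr_bilin_poincareInv ricAt_boostedKerrBilin_zero_spin)
open scoped Topology ContDiff

namespace Summit.FinalStateConjecture.FinalStateConjecture.Theorems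

namespace DragDefect

/-! ### Algebra: the dragged superposition minus the affine pull-back -/

section Algebra

variable {E : Type*} [NormedAddCommGroup E] [NormedSpace ℝ E]

/-- Pull-back of a form by `1 + A`, expanded. [folklore] -/
theorem bilinearComp_id_add' (β : E →L[ℝ] E →L[ℝ] ℝ) (A : E →L[ℝ] E) :
    β.bilinearComp (ContinuousLinearMap.id ℝ E + A) (ContinuousLinearMap.id ℝ E + A) =
      β + β.comp A + (ContinuousLinearMap.precomp ℝ A).comp β
        + (ContinuousLinearMap.precomp ℝ A).comp (β.comp A) := by
  ext v w
  simp only [bilinearComp_apply, _root_.add_apply, id_apply, map_add,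
    ContinuousLinearMap.comp_apply, ContinuousLinearMap.precomp_apply]
  abel

/-- **The dragged superposition minus the affine pull-back, pointwise.** For form fields `P, Q`,
a constant form `η₀`, a linear map `A` and a constant form `c` with `η₀(A·,·) + η₀(·,A·) = c`:
`[η₀ + (P y − η₀) + (Q y − η₀) + (D(P−η₀)(y)[Ay] + (P y − η₀)∘A + ((P y − η₀)·)∘A)]
 − (P(y + Ay))((1+A)·,(1+A)·) = (Q y − η₀ − c) − η₀(A·,A·) + E(y)` with the drag error `E`
displayed. Pure algebra (no differentiability is used). [folklore] -/
theorem dragged_sub_pullback (P Q : E → E →L[ℝ] E →L[ℝ] ℝ) (η₀ c : E →L[ℝ] E →L[ℝ] ℝ)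
    (A : E →L[ℝ] E) (hA : η₀.comp A + (ContinuousLinearMap.precomp ℝ A).comp η₀ = c) (y : E) :
    (η₀ + (P y - η₀) + (Q y - η₀)
        + (fderiv ℝ (fun z ↦ P z - η₀) y (A y) + (P y - η₀).comp A
          + (ContinuousLinearMap.precomp ℝ A).comp (P y - η₀)))
      - (P (y + A y)).bilinearComp (ContinuousLinearMap.id ℝ E + A)
          (ContinuousLinearMap.id ℝ E + A) =
      (Q y - η₀ - c) - (ContinuousLinearMap.precomp ℝ A).comp (η₀.comp A)
        + ((P y - η₀) + fderiv ℝ (fun z ↦ P z - η₀) y (A y) + (P y - η₀).comp A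
          + (ContinuousLinearMap.precomp ℝ A).comp (P y - η₀)
          - (P (y + A y) - η₀).bilinearComp (ContinuousLinearMap.id ℝ E + A)
              (ContinuousLinearMap.id ℝ E + A)) := by
  rw [bilinearComp_id_add', bilinearComp_id_add', ← hA]
  simp only [ContinuousLinearMap.sub_comp, ContinuousLinearMap.comp_sub]
  abel

/-- **Scalar components of the drag error**: with `ψ_{v,w}(z) = (P z − η₀)(v, w)`,
`E(y)(v,w) = −[ψ_{v,w}(y+Ay) − ψ_{v,w}(y) − D(P−η₀)(y)(Ay)(v,w)] − [ψ_{Av,w}(y+Ay) − ψ_{Av,w}(y)]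
 − [ψ_{v,Aw}(y+Ay) − ψ_{v,Aw}(y)] − ψ_{Av,Aw}(y+Ay)`. [folklore] -/
theorem dragError_apply (P : E → E →L[ℝ] E →L[ℝ] ℝ) (η₀ : E →L[ℝ] E →L[ℝ] ℝ) (A : E →L[ℝ] E)
    (y v w : E) :
    ((P y - η₀) + fderiv ℝ (fun z ↦ P z - η₀) y (A y) + (P y - η₀).comp A
        + (ContinuousLinearMap.precomp ℝ A).comp (P y - η₀)
        - (P (y + A y) - η₀).bilinearComp (ContinuousLinearMap.id ℝ E + A)
            (ContinuousLinearMap.id ℝ E + A)) v w =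
      -((P (y + A y) - η₀) v w - (P y - η₀) v w - fderiv ℝ (fun z ↦ P z - η₀) y (A y) v w)
        - ((P (y + A y) - η₀) (A v) w - (P y - η₀) (A v) w)
        - ((P (y + A y) - η₀) v (A w) - (P y - η₀) v (A w))
        - (P (y + A y) - η₀) (A v) (A w) := by
  simp only [bilinearComp_id_add', _root_.add_apply, _root_.sub_apply,
    ContinuousLinearMap.comp_apply, ContinuousLinearMap.precomp_apply]
  ring

/-- The affine pull-back is `MetricCoord.pullMetric` along `y ↦ y + Ay`. [folklore] -/
theorem pullMetric_affine (P : E → E →L[ℝ] E →L[ℝ] ℝ) (A : E →L[ℝ] E) (y : E) :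
    pullMetric P (fun z ↦ z + A z) y =
      (P (y + A y)).bilinearComp (ContinuousLinearMap.id ℝ E + A)
        (ContinuousLinearMap.id ℝ E + A) := by
  have hD : fderiv ℝ (fun z : E ↦ z + A z) y = ContinuousLinearMap.id ℝ E + A :=
    ((hasFDerivAt_id y).add A.hasFDerivAt).fderiv
  rw [pullMetric, hD]

end Algebra

/-! ### The affine pull-back of the Schwarzschild field is Ricci-flat -/

section Pullback

/-- `y ↦ y + Ay` is a change of coordinates from `{‖(y + Ay)̲‖ > 0}` onto `{r > 0}` when `1 + A`
is invertible. [folklore] -/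
theorem isCoordChangeOn_affine {A : E4 →L[ℝ] E4}
    (hA : (ContinuousLinearMap.id ℝ E4 + A).IsInvertible) :
    IsCoordChangeOn (fun y : E4 ↦ y + A y)
      ((fun y : E4 ↦ y + A y) ⁻¹' (Kerr.region 0 0 : Set E4)) (Kerr.region 0 0 : Set E4) where
  isOpen := (Kerr.region 0 0).isOpen.preimage (continuous_id.add A.continuous)
  contDiffOn := (contDiff_id.add A.contDiff).contDiffOn
  mapsTo _ hy := hy
  isInvertible y _ := by
    have hD : HasFDerivAt (fun z : E4 ↦ z + A z) (ContinuousLinearMap.id ℝ E4 + A) y :=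
      (hasFDerivAt_id y).add A.hasFDerivAt
    rw [hD.fderiv]
    exact hA

/-- Membership in `{r > 0}` for spin `0` is positivity of the spatial norm. [folklore] -/
theorem mem_region_zero_iff (y : E4) : y ∈ (Kerr.region 0 0 : Set E4) ↔ 0 < E4.spatialNorm y := by
  rw [SetLike.mem_coe, Kerr.mem_region, max_self, Kerr.radius_zero_left]

/-- **The affine pull-back of the Schwarzschild components is a field of metric components** on
`{‖(y + Ay)̲‖ > 0}`. [cite: ONeill1983, Ch. 3, Def. 3.9 ff.] -/
theorem isMetricOn_pullback_kerr (M : ℝ) {A : E4 →L[ℝ] E4}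
    (hA : (ContinuousLinearMap.id ℝ E4 + A).IsInvertible) :
    IsMetricOn (pullMetric (Kerr.bilin M 0) (fun y : E4 ↦ y + A y))
      ((fun y : E4 ↦ y + A y) ⁻¹' (Kerr.region 0 0 : Set E4)) :=
  (isMetricOn_kerr_bilin M 0).isMetricOn_pullMetric (isCoordChangeOn_affine hA)

/-- **The affine pull-back of the Schwarzschild components is Ricci-flat**: for
`0 < ‖(x + Ax)̲‖`, `Ric((1+A)^*g_{M,0})(x) = 0` (naturality of the coordinate Ricci form and
`Ric(g_{M,0}) = 0`). [cite: ONeill1983, Ch. 3, Cor. 3.61] -/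
theorem ricAt_pullback_kerr_eq_zero (M : ℝ) {A : E4 →L[ℝ] E4}
    (hA : (ContinuousLinearMap.id ℝ E4 + A).IsInvertible) {x : E4}
    (hx : 0 < E4.spatialNorm (x + A x)) :
    ricAt (pullMetric (Kerr.bilin M 0) (fun y : E4 ↦ y + A y)) x = 0 := by
  have hx' : x ∈ (fun y : E4 ↦ y + A y) ⁻¹' (Kerr.region 0 0 : Set E4) := by
    rw [mem_preimage, mem_region_zero_iff]; exact hx
  refine (isMetricOn_kerr_bilin M 0).ricAt_pullMetric_eq_zero (isCoordChangeOn_affine hA) hx' ?_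
  have hr : 0 < Kerr.radius 0 (x + A x) := by rwa [Kerr.radius_zero_left]
  ext Y Z
  rw [ricAt_kerr_bilin_zero_spin M hr Y Z]
  rfl

end Pullback

/-! ### The constant field `η` and the translated hole -/

section Constant

/-- **The constant field `η` is a field of metric components** on every open set. [folklore] -/
theorem isMetricOn_const_minkowski {V : Set E4} (hV : IsOpen V) :
    IsMetricOn (fun _ : E4 ↦ (Minkowski.bilin : E4 →L[ℝ] E4 →L[ℝ] ℝ)) V where
  isOpen := hV
  contDiffOn := contDiffOn_const
  symm _ _ v w := Minkowski.bilin_symm v w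
  isInvertible _ _ := isInvertible_of_nondegenerate Minkowski.bilin_nondegenerate

/-- The constant field `η` is the Kerr–Schild field of mass `0`. [cite: KerrSchild1965, §1] -/
theorem const_minkowski_eq_kerr_zero :
    (fun _ : E4 ↦ (Minkowski.bilin : E4 →L[ℝ] E4 →L[ℝ] ℝ)) = Kerr.bilin 0 0 := by
  funext y
  rw [Kerr.bilin_zero_left]

/-- **The constant field `η` has vanishing coordinate Ricci form** (off the time axis, where the
bridge `ricAt_kerr_bilin_zero_spin` with `M = 0` applies). [folklore] -/
theorem ricAt_const_minkowski {x : E4} (hx : 0 < E4.spatialNorm x) :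
    ricAt (fun _ : E4 ↦ (Minkowski.bilin : E4 →L[ℝ] E4 →L[ℝ] ℝ)) x = 0 := by
  rw [const_minkowski_eq_kerr_zero]
  have hr : 0 < Kerr.radius 0 x := by rwa [Kerr.radius_zero_left]
  ext Y Z
  rw [ricAt_kerr_bilin_zero_spin 0 hr Y Z]
  rfl

/-- The translated hole is the unboosted translated Kerr–Schild field. [cite: KerrSchild1965, §2] -/
theorem kerr_sub_eq_boosted (M : ℝ) (c₂ : E4) :
    (fun y : E4 ↦ Kerr.bilin M 0 (y - c₂)) = boostedKerrBilin 1 c₂ M 0 := by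
  funext y
  ext v w
  rw [boostedKerrBilin_apply, poincareInv]
  rfl

/-- **The translated hole `y ↦ g_{M,0}(y − c₂)` is a field of metric components** off the
translated time axis. [cite: KerrSchild1965, §3] -/
theorem isMetricOn_kerr_sub (M : ℝ) (c₂ : E4) :
    IsMetricOn (fun y : E4 ↦ Kerr.bilin M 0 (y - c₂)) {y : E4 | 0 < E4.spatialNorm (y - c₂)} := by
  have h := (isMetricOn_kerr_bilin M 0).isMetricOn_pullMetric (isCoordChangeOn_poincareInv 1 c₂ 0)
  rw [pullMetric_kerr_bilin_poincareInv, ← kerr_sub_eq_boosted] at h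
  have hset : poincareInv 1 c₂ ⁻¹' (Kerr.region 0 0 : Set E4) =
      {y : E4 | 0 < E4.spatialNorm (y - c₂)} := by
    ext y
    rw [mem_preimage, mem_region_zero_iff, poincareInv]
    rfl
  rwa [hset] at h

/-- **The translated hole has vanishing coordinate Ricci form** off its axis.
[cite: KerrSchild1965, §3] -/
theorem ricAt_kerr_sub (M : ℝ) (c₂ : E4) {x : E4} (hx : 0 < E4.spatialNorm (x - c₂)) :
    ricAt (fun y : E4 ↦ Kerr.bilin M 0 (y - c₂)) x = 0 := by
  rw [kerr_sub_eq_boosted]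
  have hr : 0 < Kerr.radius 0 (poincareInv 1 c₂ x) := by
    rw [Kerr.radius_zero_left, poincareInv]; exact hx
  ext Y Z
  rw [ricAt_boostedKerrBilin_zero_spin 1 c₂ M hr Y Z]
  rfl

end Constant

/-! ### The dragged superposition: smoothness, symmetry, metric components -/

section Dragged

variable {P Q : E4 → E4 →L[ℝ] E4 →L[ℝ] ℝ} {WP WQ : Set E4} {A : E4 →L[ℝ] E4} {y : E4}

/-- `D(P − η)` is `C^∞` at the points of `WP`. [folklore] -/
theorem contDiffAt_fderiv_sub_const (hP : IsMetricOn P WP) (hy : y ∈ WP) :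
    ContDiffAt ℝ ∞ (fderiv ℝ (fun z ↦ P z - (Minkowski.bilin : E4 →L[ℝ] E4 →L[ℝ] ℝ))) y := by
  have h : fderiv ℝ (fun z ↦ P z - (Minkowski.bilin : E4 →L[ℝ] E4 →L[ℝ] ℝ)) = fderiv ℝ P := by
    funext z; exact fderiv_sub_const _
  rw [h]
  exact hP.contDiffAt_fderiv hy

/-- **The dragged superposition is `C^∞` off the two axes.** [folklore] -/
theorem contDiffAt_dragged (hP : IsMetricOn P WP) (hQ : IsMetricOn Q WQ) (hyP : y ∈ WP)
    (hyQ : y ∈ WQ) :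
    ContDiffAt ℝ ∞ (fun y ↦ (Minkowski.bilin : E4 →L[ℝ] E4 →L[ℝ] ℝ) + (P y - Minkowski.bilin)
      + (Q y - Minkowski.bilin)
      + (fderiv ℝ (fun z ↦ P z - (Minkowski.bilin : E4 →L[ℝ] E4 →L[ℝ] ℝ)) y (A y)
        + (P y - Minkowski.bilin).comp A
        + (ContinuousLinearMap.precomp ℝ A).comp (P y - Minkowski.bilin))) y := by
  have hP' : ContDiffAt ℝ ∞ (fun y ↦ P y - (Minkowski.bilin : E4 →L[ℝ] E4 →L[ℝ] ℝ)) y :=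
    (hP.contDiffAt hyP).sub contDiffAt_const
  have hQ' : ContDiffAt ℝ ∞ (fun y ↦ Q y - (Minkowski.bilin : E4 →L[ℝ] E4 →L[ℝ] ℝ)) y :=
    (hQ.contDiffAt hyQ).sub contDiffAt_const
  have hA : ContDiffAt ℝ ∞ (fun y : E4 ↦ A y) y := A.contDiff.contDiffAt
  have h1 : ContDiffAt ℝ ∞
      (fun y ↦ fderiv ℝ (fun z ↦ P z - (Minkowski.bilin : E4 →L[ℝ] E4 →L[ℝ] ℝ)) y (A y)) y :=
    (contDiffAt_fderiv_sub_const hP hyP).clm_apply hA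
  have h2 : ContDiffAt ℝ ∞ (fun y ↦ (P y - (Minkowski.bilin : E4 →L[ℝ] E4 →L[ℝ] ℝ)).comp A) y :=
    hP'.clm_comp contDiffAt_const
  have h3 : ContDiffAt ℝ ∞ (fun y ↦ (ContinuousLinearMap.precomp ℝ A).comp
      (P y - (Minkowski.bilin : E4 →L[ℝ] E4 →L[ℝ] ℝ))) y :=
    contDiffAt_const.clm_comp hP'
  exact ((contDiffAt_const.add hP').add hQ').add ((h1.add h2).add h3)

/-- **The dragged superposition is symmetric** (each summand is; the derivative of a field of
symmetric forms is symmetric, `MetricCoord.IsMetricOn.fderiv_symm`). [folklore] -/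
theorem dragged_symm (hP : IsMetricOn P WP) (hQ : IsMetricOn Q WQ) (hyP : y ∈ WP) (hyQ : y ∈ WQ)
    (v w : E4) :
    ((Minkowski.bilin : E4 →L[ℝ] E4 →L[ℝ] ℝ) + (P y - Minkowski.bilin) + (Q y - Minkowski.bilin)
      + (fderiv ℝ (fun z ↦ P z - (Minkowski.bilin : E4 →L[ℝ] E4 →L[ℝ] ℝ)) y (A y)
        + (P y - Minkowski.bilin).comp A
        + (ContinuousLinearMap.precomp ℝ A).comp (P y - Minkowski.bilin))) v w =
    ((Minkowski.bilin : E4 →L[ℝ] E4 →L[ℝ] ℝ) + (P y - Minkowski.bilin) + (Q y - Minkowski.bilin)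
      + (fderiv ℝ (fun z ↦ P z - (Minkowski.bilin : E4 →L[ℝ] E4 →L[ℝ] ℝ)) y (A y)
        + (P y - Minkowski.bilin).comp A
        + (ContinuousLinearMap.precomp ℝ A).comp (P y - Minkowski.bilin))) w v := by
  have hD : fderiv ℝ (fun z ↦ P z - (Minkowski.bilin : E4 →L[ℝ] E4 →L[ℝ] ℝ)) y = fderiv ℝ P y :=
    fderiv_sub_const _
  simp only [_root_.add_apply, _root_.sub_apply, ContinuousLinearMap.comp_apply,
    ContinuousLinearMap.precomp_apply, hD]
  rw [Minkowski.bilin_symm v w, Minkowski.bilin_symm (A v) w, Minkowski.bilin_symm v (A w),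
    hP.symm y hyP v w, hQ.symm y hyQ v w, hP.fderiv_symm hyP (A y) v w, hP.symm y hyP (A v) w,
    hP.symm y hyP v (A w)]
  ring

/-- The set of invertible continuous linear maps is the range of the equivalences. [folklore] -/
theorem setOf_isInvertible_eq {E F : Type*} [NormedAddCommGroup E] [NormedSpace ℝ E]
    [NormedAddCommGroup F] [NormedSpace ℝ F] :
    {f : E →L[ℝ] F | f.IsInvertible} = range ((↑) : (E ≃L[ℝ] F) → E →L[ℝ] F) := rfl

/-- **The dragged superposition gives metric components on the open set where it is
invertible** (within the common domain of the two holes). [folklore] -/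
theorem isMetricOn_dragged (hP : IsMetricOn P WP) (hQ : IsMetricOn Q WQ) :
    IsMetricOn (fun y ↦ (Minkowski.bilin : E4 →L[ℝ] E4 →L[ℝ] ℝ) + (P y - Minkowski.bilin)
      + (Q y - Minkowski.bilin)
      + (fderiv ℝ (fun z ↦ P z - (Minkowski.bilin : E4 →L[ℝ] E4 →L[ℝ] ℝ)) y (A y)
        + (P y - Minkowski.bilin).comp A
        + (ContinuousLinearMap.precomp ℝ A).comp (P y - Minkowski.bilin)))
      {y : E4 | y ∈ WP ∩ WQ ∧
        ((Minkowski.bilin : E4 →L[ℝ] E4 →L[ℝ] ℝ) + (P y - Minkowski.bilin)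
          + (Q y - Minkowski.bilin)
          + (fderiv ℝ (fun z ↦ P z - (Minkowski.bilin : E4 →L[ℝ] E4 →L[ℝ] ℝ)) y (A y)
            + (P y - Minkowski.bilin).comp A
            + (ContinuousLinearMap.precomp ℝ A).comp (P y - Minkowski.bilin))).IsInvertible} := by
  set F : E4 → E4 →L[ℝ] E4 →L[ℝ] ℝ := fun y ↦ (Minkowski.bilin : E4 →L[ℝ] E4 →L[ℝ] ℝ)
      + (P y - Minkowski.bilin) + (Q y - Minkowski.bilin)
      + (fderiv ℝ (fun z ↦ P z - (Minkowski.bilin : E4 →L[ℝ] E4 →L[ℝ] ℝ)) y (A y)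
        + (P y - Minkowski.bilin).comp A
        + (ContinuousLinearMap.precomp ℝ A).comp (P y - Minkowski.bilin)) with hF
  have hWo : IsOpen (WP ∩ WQ) := hP.isOpen.inter hQ.isOpen
  have hcont : ContinuousOn F (WP ∩ WQ) := fun y hy ↦
    (contDiffAt_dragged (A := A) hP hQ hy.1 hy.2).continuousAt.continuousWithinAt
  have hset : {y : E4 | y ∈ WP ∩ WQ ∧ (F y).IsInvertible} =
      (WP ∩ WQ) ∩ F ⁻¹' range ((↑) : (E4 ≃L[ℝ] (E4 →L[ℝ] ℝ)) → E4 →L[ℝ] E4 →L[ℝ] ℝ) := by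
    rw [← setOf_isInvertible_eq]; rfl
  have hopen : IsOpen {y : E4 | y ∈ WP ∩ WQ ∧ (F y).IsInvertible} := by
    rw [hset]
    exact hcont.isOpen_inter_preimage hWo ContinuousLinearEquiv.isOpen
  exact
  { isOpen := hopen
    contDiffOn := fun y hy ↦ (contDiffAt_dragged hP hQ hy.1.1 hy.1.2).contDiffWithinAt
    symm := fun y hy v w ↦ dragged_symm hP hQ hy.1.1 hy.1.2 v w
    isInvertible := fun y hy ↦ hy.2 }

end Dragged

/-- **Registered sub-goal form** (stub `dragDefect_dragged_sub_pullback` of the crux item) of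
`dragged_sub_pullback`. [folklore] -/
theorem dragDefect_dragged_sub_pullback : ∀ {E : Type*} [NormedAddCommGroup E] [NormedSpace ℝ E] (P Q : E → E →L[ℝ] E →L[ℝ] ℝ) (η₀ c : E →L[ℝ] E →L[ℝ] ℝ) (A : E →L[ℝ] E), η₀.comp A + (ContinuousLinearMap.precomp ℝ A).comp η₀ = c → ∀ y : E, (η₀ + (P y - η₀) + (Q y - η₀) + (fderiv ℝ (fun z ↦ P z - η₀) y (A y) + (P y - η₀).comp A + (ContinuousLinearMap.precomp ℝ A).comp (P y - η₀))) - (P (y + A y)).bilinearComp (ContinuousLinearMap.id ℝ E + A) (ContinuousLinearMap.id ℝ E + A) = (Q y - η₀ - c) - (ContinuousLinearMap.precomp ℝ A).comp (η₀.comp A) + ((P y - η₀) + fderiv ℝ (fun z ↦ P z - η₀) y (A y) + (P y - η₀).comp A + (ContinuousLinearMap.precomp ℝ A).comp (P y - η₀) - (P (y + A y) - η₀).bilinearComp (ContinuousLinearMap.id ℝ E + A) (ContinuousLinearMap.id ℝ E + A)) :=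
  fun P Q η₀ c A hA y ↦ dragged_sub_pullback P Q η₀ c A hA y

end DragDefect

end Summit.FinalStateConjecture.FinalStateConjecture.Theorems

end
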